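/-
Copyright: the b2b-balaban T⁴-continuum CRUX team, row NE7b OWNER lineage `t4-ne7b-p1` (gen 143). Project licence.
-/
import Summits.QuantumFields.BalabanUV.T4Continuum.Spine.NE7b.SupTiltedCumulantCalculusOne

/-!
# THE FOUR OBSERVABLE FAMILIES OF THE ORDER-4 DISPLAY ARE IN THE GROWTH CLASS (SCOPING (d15); inputs of the cumulant rules (581)∕(583)∕(589)
# for the FORM of `∂⁵W`).  (521)'s centred display of `∂⁴W(ψ)[m,h,k,l]` is built from `A_v = U′(·)v`, `B_{xy} = U″(·)xy`, `C_{xyz} =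
# U‴(·)xyz`, `D = U⁗(·)mhkl`; along a fifth direction `n` their derivatives are `U″(·)nv`, `U‴(·)nxy`, `U⁗(·)nxyz`, `U⁽⁵⁾(·)nmhkl`.  This file
# records, for each family, (513)'s class data WITH ONE CONSTANT for value and derivative (`|p| ≤ C(1+‖U′‖)^0`, `‖p′‖ ≤ C(1+‖U′‖)^0`,
# `C = Π‖slots‖·(κ_j + κ_{j+1})`), the `HasFDerivAt`, the continuity of `p′`, and the evaluation identities `p′(φ)n = U^{(j+1)}(φ)n…` that turn
# the rules' generic outputs into display letters (row NE7b, node U5c; (514) `hasFDerivAt_entry_one∕two`, `norm_eval_comp_one∕two_le`,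
# `abs_entry_one∕two_le`, (515) `hasFDerivAt_entry_three`, `norm_eval_comp_three_le`, `abs_entry_three_le` BY NAME; [folklore])

Cell `pub-balaban`, sub-cell `t4`, spine estimate NE7b (`T4WeightBudget.RelWeightBound`; the cell's OWN estimate — NOT PRINTED in
[Bałaban 1983–89], NOT PROVED).  Crux-route work under `Spine/NE7b/` by the row OWNER (`t4-ne7b-p1` gen 143, file (590)) under FREEZE
(0)'s crux-prover clause; NOTHING of Bałaban's is named as a Lean object, valued or asserted; no `T4Continuum/Support` leaf typed; no
`def`, no notation; zero `sorry`.  Imports (BY NAME): the OWNER's (581) `…SupTiltedCumulantCalculusOne` (through it (514), (515)).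

WHAT IS PROVED ([folklore]): `hasFDerivAt_entry_four`, `norm_eval_comp_four_le`, `abs_entry_four_le`; the evaluation identities
`entry_one∕two∕three∕four_fderiv_apply`; the class bounds `class_hess_abs_le`, `class_hess_fderiv_le`, `class_third_abs_le`, `class_third_fderiv_le`,
`class_fourth_abs_le`, `class_fourth_fderiv_le`; the continuity lemmas `continuous_entry_one∕two∕three∕four_fderiv`; toy.

HONEST (what this is NOT).  Operator-norm bookkeeping only.  Scalar skeleton ((A3), NC-NE7b-α UNRULED); nothing of Bałaban's asserted.  BY-NAME
EFFECT ON THE WALL: NONE.  NE7b NOT PRINTED ∕ NOT PROVED; spine PROVED 0∕9; rung (B)+1 — the programme's measures remain FINITE-torus statements;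
NOT the mass gap, NOT Clay.  HONEST DEPENDENCY: continuum YM on T⁴ ⇐ BetaPertH ∧ nine spine estimates (0∕9 proved); BetaPertH ⇐ (D1) ∧ (D4) ∧
CAP+tail; G-an2-4 gates asym, D1 and NE2∕3∕4.
-/

set_option autoImplicit false
set_option maxSynthPendingDepth 4

noncomputable section

namespace Summit.QuantumFields.BalabanUV.T4Continuum.NE7b.SupFifthFormObservables

open MeasureTheory ProbabilityTheory Real Set Function Finset Matrix
open scoped BigOperators
open SupTiltedMomentConstituents (norm_eval_comp_one_le norm_eval_comp_two_le abs_entry_one_le abs_entry_two_le)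
open SupTiltedMomentPhiConstituent (norm_eval_comp_three_le abs_entry_three_le)

variable {ι : Type} [Fintype ι]

variable {U' : EuclideanSpace ℝ ι → EuclideanSpace ℝ ι →L[ℝ] ℝ} {U'' : EuclideanSpace ℝ ι → EuclideanSpace ℝ ι →L[ℝ] EuclideanSpace ℝ ι →L[ℝ] ℝ}
  {U₃ : EuclideanSpace ℝ ι → EuclideanSpace ℝ ι →L[ℝ] EuclideanSpace ℝ ι →L[ℝ] EuclideanSpace ℝ ι →L[ℝ] ℝ}
  {U₄ : EuclideanSpace ℝ ι → EuclideanSpace ℝ ι →L[ℝ] EuclideanSpace ℝ ι →L[ℝ] EuclideanSpace ℝ ι →L[ℝ] EuclideanSpace ℝ ι →L[ℝ] ℝ}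
  {U₅ : EuclideanSpace ℝ ι →
    EuclideanSpace ℝ ι →L[ℝ] EuclideanSpace ℝ ι →L[ℝ] EuclideanSpace ℝ ι →L[ℝ] EuclideanSpace ℝ ι →L[ℝ] EuclideanSpace ℝ ι →L[ℝ] ℝ}
  {κ₂ κ₃ κ₄ κ₅ : ℝ}

/-! ## §1. The fourth-derivative entry: derivative, operator norm, absolute value -/

set_option synthInstance.maxHeartbeats 200000 in
/-- `φ ↦ U⁗φ m h k l` has derivative `(ev_l ∘ ev_k ∘ ev_h ∘ ev_m) ∘ U⁽⁵⁾φ`. [folklore] -/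
theorem hasFDerivAt_entry_four (hU₄d : ∀ φ : EuclideanSpace ℝ ι, HasFDerivAt U₄ (U₅ φ) φ) (m h k l φ : EuclideanSpace ℝ ι) :
    HasFDerivAt (fun φ : EuclideanSpace ℝ ι => U₄ φ m h k l) (((((ContinuousLinearMap.apply ℝ ℝ l).comp (ContinuousLinearMap.apply ℝ (EuclideanSpace
        ℝ ι →L[ℝ] ℝ) k)).comp (ContinuousLinearMap.apply ℝ (EuclideanSpace ℝ ι →L[ℝ] EuclideanSpace ℝ ι →L[ℝ] ℝ) h)).comp
        (ContinuousLinearMap.apply ℝ (EuclideanSpace ℝ ι →L[ℝ] EuclideanSpace ℝ ι →L[ℝ] EuclideanSpace ℝ ι →L[ℝ] ℝ) m)).comp (U₅ φ)) φ := by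
  have h1 := (((((ContinuousLinearMap.apply ℝ ℝ l).comp (ContinuousLinearMap.apply ℝ (EuclideanSpace ℝ ι →L[ℝ] ℝ) k)).comp (ContinuousLinearMap.apply
      ℝ (EuclideanSpace ℝ ι →L[ℝ] EuclideanSpace ℝ ι →L[ℝ] ℝ) h)).comp
        (ContinuousLinearMap.apply ℝ (EuclideanSpace ℝ ι →L[ℝ] EuclideanSpace ℝ ι →L[ℝ] EuclideanSpace ℝ ι →L[ℝ] ℝ) m))).hasFDerivAt.comp φ (hU₄d φ)
  simpa [Function.comp_def] using h1

set_option synthInstance.maxHeartbeats 200000 in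
/-- `‖(ev_l ∘ ev_k ∘ ev_h ∘ ev_m) ∘ P‖ ≤ ‖m‖‖h‖‖k‖‖l‖‖P‖`. [folklore] -/
theorem norm_eval_comp_four_le
    (P : EuclideanSpace ℝ ι →L[ℝ] EuclideanSpace ℝ ι →L[ℝ] EuclideanSpace ℝ ι →L[ℝ] EuclideanSpace ℝ ι →L[ℝ] EuclideanSpace ℝ ι →L[ℝ] ℝ)
    (m h k l : EuclideanSpace ℝ ι) : ‖((((ContinuousLinearMap.apply ℝ ℝ l).comp (ContinuousLinearMap.apply ℝ (EuclideanSpace ℝ ι →L[ℝ] ℝ) k)).comp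
        (ContinuousLinearMap.apply ℝ (EuclideanSpace ℝ ι →L[ℝ] EuclideanSpace ℝ ι →L[ℝ] ℝ) h)).comp
        (ContinuousLinearMap.apply ℝ (EuclideanSpace ℝ ι →L[ℝ] EuclideanSpace ℝ ι →L[ℝ] EuclideanSpace ℝ ι →L[ℝ] ℝ) m)).comp P‖ ≤ ‖m‖ * ‖h‖ * ‖k‖ *
            ‖l‖ * ‖P‖ := by
  refine ContinuousLinearMap.opNorm_le_bound _ (by positivity) fun u => ?_
  simp only [ContinuousLinearMap.coe_comp, Function.comp_apply, ContinuousLinearMap.apply_apply]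
  calc ‖P u m h k l‖ ≤ ‖P u m h k‖ * ‖l‖ := ContinuousLinearMap.le_opNorm _ _
    _ ≤ ‖P u m h‖ * ‖k‖ * ‖l‖ := mul_le_mul_of_nonneg_right (ContinuousLinearMap.le_opNorm _ _) (norm_nonneg _)
    _ ≤ ‖P u m‖ * ‖h‖ * ‖k‖ * ‖l‖ :=
      mul_le_mul_of_nonneg_right (mul_le_mul_of_nonneg_right (ContinuousLinearMap.le_opNorm _ _) (norm_nonneg _)) (norm_nonneg _)
    _ ≤ ‖P u‖ * ‖m‖ * ‖h‖ * ‖k‖ * ‖l‖ := mul_le_mul_of_nonneg_right (mul_le_mul_of_nonneg_right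
        (mul_le_mul_of_nonneg_right (ContinuousLinearMap.le_opNorm _ _) (norm_nonneg _)) (norm_nonneg _)) (norm_nonneg _)
    _ ≤ ‖P‖ * ‖u‖ * ‖m‖ * ‖h‖ * ‖k‖ * ‖l‖ := mul_le_mul_of_nonneg_right (mul_le_mul_of_nonneg_right (mul_le_mul_of_nonneg_right
        (mul_le_mul_of_nonneg_right (ContinuousLinearMap.le_opNorm _ _) (norm_nonneg _)) (norm_nonneg _)) (norm_nonneg _)) (norm_nonneg _)
    _ = ‖m‖ * ‖h‖ * ‖k‖ * ‖l‖ * ‖P‖ * ‖u‖ := by ring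

/-- `|U⁗φ m h k l| ≤ ‖U⁗φ‖‖m‖‖h‖‖k‖‖l‖`. [folklore] -/
theorem abs_entry_four_le (Q : EuclideanSpace ℝ ι →L[ℝ] EuclideanSpace ℝ ι →L[ℝ] EuclideanSpace ℝ ι →L[ℝ] EuclideanSpace ℝ ι →L[ℝ] ℝ)
    (m h k l : EuclideanSpace ℝ ι) : |Q m h k l| ≤ ‖Q‖ * ‖m‖ * ‖h‖ * ‖k‖ * ‖l‖ := by
  rw [← Real.norm_eq_abs]
  refine (ContinuousLinearMap.le_opNorm _ _).trans (mul_le_mul_of_nonneg_right ?_ (norm_nonneg _))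
  refine (ContinuousLinearMap.le_opNorm _ _).trans (mul_le_mul_of_nonneg_right ?_ (norm_nonneg _))
  exact (ContinuousLinearMap.le_opNorm _ _).trans (mul_le_mul_of_nonneg_right (ContinuousLinearMap.le_opNorm _ _) (norm_nonneg _))

/-! ## §2. The evaluation identities (generic rule outputs → display letters) -/

/-- `((ev_v) ∘ U″φ) n = U″φ n v`. [folklore] -/
theorem entry_one_fderiv_apply (φ n v : EuclideanSpace ℝ ι) : ((ContinuousLinearMap.apply ℝ ℝ v).comp (U'' φ)) n = U'' φ n v := rfl

/-- `((ev_y ∘ ev_x) ∘ U‴φ) n = U‴φ n x y`. [folklore] -/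
theorem entry_two_fderiv_apply (φ n x y : EuclideanSpace ℝ ι) : (((ContinuousLinearMap.apply ℝ ℝ y).comp (ContinuousLinearMap.apply ℝ (EuclideanSpace
    ℝ ι →L[ℝ] ℝ) x)).comp (U₃ φ)) n = U₃ φ n x y := rfl

/-- `((ev_z ∘ ev_y ∘ ev_x) ∘ U⁗φ) n = U⁗φ n x y z`. [folklore] -/
theorem entry_three_fderiv_apply (φ n x y z : EuclideanSpace ℝ ι) : ((((ContinuousLinearMap.apply ℝ ℝ z).comp (ContinuousLinearMap.apply ℝ
    (EuclideanSpace ℝ ι →L[ℝ] ℝ) y)).comp (ContinuousLinearMap.apply ℝ (EuclideanSpace ℝ ι →L[ℝ] EuclideanSpace ℝ ι →L[ℝ] ℝ) x)).comp (U₄ φ)) n = U₄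
    φ n x y z := rfl

set_option synthInstance.maxHeartbeats 200000 in
/-- `((ev_l ∘ ev_k ∘ ev_h ∘ ev_m) ∘ U⁽⁵⁾φ) n = U⁽⁵⁾φ n m h k l`. [folklore] -/
theorem entry_four_fderiv_apply (φ n m h k l : EuclideanSpace ℝ ι) : (((((ContinuousLinearMap.apply ℝ ℝ l).comp (ContinuousLinearMap.apply ℝ
    (EuclideanSpace ℝ ι →L[ℝ] ℝ) k)).comp (ContinuousLinearMap.apply ℝ (EuclideanSpace ℝ ι →L[ℝ] EuclideanSpace ℝ ι →L[ℝ] ℝ) h)).comp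
        (ContinuousLinearMap.apply ℝ (EuclideanSpace ℝ ι →L[ℝ] EuclideanSpace ℝ ι →L[ℝ] EuclideanSpace ℝ ι →L[ℝ] ℝ) m)).comp (U₅ φ)) n = U₅ φ n m h k
            l := rfl

/-! ## §3. One class constant for value and derivative -/

/-- **`B_{xy} = U″(·)xy`, values**: `|U″φ x y| ≤ ‖x‖‖y‖(κ₂+κ₃)(1+‖U′φ‖)^0`. [folklore] -/
theorem class_hess_abs_le (hU''b : ∀ φ : EuclideanSpace ℝ ι, ‖U'' φ‖ ≤ κ₂) (hU₃b : ∀ φ : EuclideanSpace ℝ ι, ‖U₃ φ‖ ≤ κ₃) (x y φ : EuclideanSpace ℝ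
    ι) :
    |U'' φ x y| ≤ ‖x‖ * ‖y‖ * (κ₂ + κ₃) * (1 + ‖U' φ‖) ^ 0 := by
  have hκ₃ : 0 ≤ κ₃ := (norm_nonneg (U₃ φ)).trans (hU₃b φ)
  rw [pow_zero, mul_one]
  calc |U'' φ x y| ≤ ‖U'' φ‖ * ‖x‖ * ‖y‖ := abs_entry_two_le _ _ _
    _ ≤ κ₂ * ‖x‖ * ‖y‖ := by gcongr; exact hU''b φ
    _ ≤ ‖x‖ * ‖y‖ * (κ₂ + κ₃) := by nlinarith [mul_nonneg (mul_nonneg (norm_nonneg x) (norm_nonneg y)) hκ₃]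

/-- **`B_{xy}`, derivatives**: `‖(ev_y ∘ ev_x) ∘ U‴φ‖ ≤ ‖x‖‖y‖(κ₂+κ₃)(1+‖U′φ‖)^0`. [folklore] -/
theorem class_hess_fderiv_le (hU''b : ∀ φ : EuclideanSpace ℝ ι, ‖U'' φ‖ ≤ κ₂) (hU₃b : ∀ φ : EuclideanSpace ℝ ι, ‖U₃ φ‖ ≤ κ₃) (x y φ : EuclideanSpace
    ℝ ι) :
    ‖((ContinuousLinearMap.apply ℝ ℝ y).comp (ContinuousLinearMap.apply ℝ (EuclideanSpace ℝ ι →L[ℝ] ℝ) x)).comp (U₃ φ)‖ ≤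
      ‖x‖ * ‖y‖ * (κ₂ + κ₃) * (1 + ‖U' φ‖) ^ 0 := by
  have hκ₂ : 0 ≤ κ₂ := (norm_nonneg (U'' φ)).trans (hU''b φ)
  rw [pow_zero, mul_one]
  calc _ ≤ ‖x‖ * ‖y‖ * ‖U₃ φ‖ := norm_eval_comp_two_le (U₃ φ) x y
    _ ≤ ‖x‖ * ‖y‖ * κ₃ := by gcongr; exact hU₃b φ
    _ ≤ ‖x‖ * ‖y‖ * (κ₂ + κ₃) := by nlinarith [mul_nonneg (mul_nonneg (norm_nonneg x) (norm_nonneg y)) hκ₂]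

/-- **`C_{xyz} = U‴(·)xyz`, values**: `|U‴φ x y z| ≤ ‖x‖‖y‖‖z‖(κ₃+κ₄)(1+‖U′φ‖)^0`. [folklore] -/
theorem class_third_abs_le (hU₃b : ∀ φ : EuclideanSpace ℝ ι, ‖U₃ φ‖ ≤ κ₃) (hU₄b : ∀ φ : EuclideanSpace ℝ ι, ‖U₄ φ‖ ≤ κ₄) (x y z φ : EuclideanSpace ℝ
    ι) :
    |U₃ φ x y z| ≤ ‖x‖ * ‖y‖ * ‖z‖ * (κ₃ + κ₄) * (1 + ‖U' φ‖) ^ 0 := by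
  have hκ₄ : 0 ≤ κ₄ := (norm_nonneg (U₄ φ)).trans (hU₄b φ)
  rw [pow_zero, mul_one]
  calc |U₃ φ x y z| ≤ ‖U₃ φ‖ * ‖x‖ * ‖y‖ * ‖z‖ := abs_entry_three_le _ _ _ _
    _ ≤ κ₃ * ‖x‖ * ‖y‖ * ‖z‖ := by gcongr; exact hU₃b φ
    _ ≤ ‖x‖ * ‖y‖ * ‖z‖ * (κ₃ + κ₄) := by nlinarith [mul_nonneg (mul_nonneg (mul_nonneg (norm_nonneg x) (norm_nonneg y)) (norm_nonneg z)) hκ₄]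

/-- **`C_{xyz}`, derivatives**: `‖(ev_z ∘ ev_y ∘ ev_x) ∘ U⁗φ‖ ≤ ‖x‖‖y‖‖z‖(κ₃+κ₄)(1+‖U′φ‖)^0`. [folklore] -/
theorem class_third_fderiv_le (hU₃b : ∀ φ : EuclideanSpace ℝ ι, ‖U₃ φ‖ ≤ κ₃) (hU₄b : ∀ φ : EuclideanSpace ℝ ι, ‖U₄ φ‖ ≤ κ₄) (x y z φ : EuclideanSpace
    ℝ ι) :
    ‖(((ContinuousLinearMap.apply ℝ ℝ z).comp (ContinuousLinearMap.apply ℝ (EuclideanSpace ℝ ι →L[ℝ] ℝ) y)).comp (ContinuousLinearMap.apply ℝ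
        (EuclideanSpace ℝ ι →L[ℝ] EuclideanSpace ℝ ι →L[ℝ] ℝ) x)).comp (U₄ φ)‖ ≤
      ‖x‖ * ‖y‖ * ‖z‖ * (κ₃ + κ₄) * (1 + ‖U' φ‖) ^ 0 := by
  have hκ₃ : 0 ≤ κ₃ := (norm_nonneg (U₃ φ)).trans (hU₃b φ)
  rw [pow_zero, mul_one]
  calc _ ≤ ‖x‖ * ‖y‖ * ‖z‖ * ‖U₄ φ‖ := norm_eval_comp_three_le (U₄ φ) x y z
    _ ≤ ‖x‖ * ‖y‖ * ‖z‖ * κ₄ := by gcongr; exact hU₄b φ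
    _ ≤ ‖x‖ * ‖y‖ * ‖z‖ * (κ₃ + κ₄) := by nlinarith [mul_nonneg (mul_nonneg (mul_nonneg (norm_nonneg x) (norm_nonneg y)) (norm_nonneg z)) hκ₃]

/-- **`D = U⁗(·)mhkl`, values**: `|U⁗φ m h k l| ≤ ‖m‖‖h‖‖k‖‖l‖(κ₄+κ₅)(1+‖U′φ‖)^0`. [folklore] -/
theorem class_fourth_abs_le (hU₄b : ∀ φ : EuclideanSpace ℝ ι, ‖U₄ φ‖ ≤ κ₄) (hU₅b : ∀ φ : EuclideanSpace ℝ ι, ‖U₅ φ‖ ≤ κ₅) (m h k l φ : EuclideanSpace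
    ℝ ι) :
    |U₄ φ m h k l| ≤ ‖m‖ * ‖h‖ * ‖k‖ * ‖l‖ * (κ₄ + κ₅) * (1 + ‖U' φ‖) ^ 0 := by
  have hκ₅ : 0 ≤ κ₅ := (norm_nonneg (U₅ φ)).trans (hU₅b φ)
  rw [pow_zero, mul_one]
  calc |U₄ φ m h k l| ≤ ‖U₄ φ‖ * ‖m‖ * ‖h‖ * ‖k‖ * ‖l‖ := abs_entry_four_le _ _ _ _ _
    _ ≤ κ₄ * ‖m‖ * ‖h‖ * ‖k‖ * ‖l‖ := by gcongr; exact hU₄b φ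
    _ ≤ ‖m‖ * ‖h‖ * ‖k‖ * ‖l‖ * (κ₄ + κ₅) := by
      nlinarith [mul_nonneg (mul_nonneg (mul_nonneg (mul_nonneg (norm_nonneg m) (norm_nonneg h)) (norm_nonneg k)) (norm_nonneg l)) hκ₅]

set_option synthInstance.maxHeartbeats 200000 in
set_option maxHeartbeats 400000 in
/-- **`D`, derivatives**: `‖(ev_l ∘ ev_k ∘ ev_h ∘ ev_m) ∘ U⁽⁵⁾φ‖ ≤ ‖m‖‖h‖‖k‖‖l‖(κ₄+κ₅)(1+‖U′φ‖)^0`. [folklore] -/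
theorem class_fourth_fderiv_le (hU₄b : ∀ φ : EuclideanSpace ℝ ι, ‖U₄ φ‖ ≤ κ₄) (hU₅b : ∀ φ : EuclideanSpace ℝ ι, ‖U₅ φ‖ ≤ κ₅)
    (m h k l φ : EuclideanSpace ℝ ι) :
    ‖((((ContinuousLinearMap.apply ℝ ℝ l).comp (ContinuousLinearMap.apply ℝ (EuclideanSpace ℝ ι →L[ℝ] ℝ) k)).comp (ContinuousLinearMap.apply ℝ
        (EuclideanSpace ℝ ι →L[ℝ] EuclideanSpace ℝ ι →L[ℝ] ℝ) h)).comp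
        (ContinuousLinearMap.apply ℝ (EuclideanSpace ℝ ι →L[ℝ] EuclideanSpace ℝ ι →L[ℝ] EuclideanSpace ℝ ι →L[ℝ] ℝ) m)).comp (U₅ φ)‖ ≤
      ‖m‖ * ‖h‖ * ‖k‖ * ‖l‖ * (κ₄ + κ₅) * (1 + ‖U' φ‖) ^ 0 := by
  have hκ₄ : 0 ≤ κ₄ := (norm_nonneg (U₄ φ)).trans (hU₄b φ)
  have h1 := norm_eval_comp_four_le (U₅ φ) m h k l
  have h0 : 0 ≤ ‖m‖ * ‖h‖ * ‖k‖ * ‖l‖ := by positivity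
  have h2 : ‖m‖ * ‖h‖ * ‖k‖ * ‖l‖ * ‖U₅ φ‖ ≤ ‖m‖ * ‖h‖ * ‖k‖ * ‖l‖ * κ₅ := mul_le_mul_of_nonneg_left (hU₅b φ) h0
  rw [pow_zero, mul_one]
  exact h1.trans (h2.trans (by nlinarith [mul_nonneg h0 hκ₄]))

/-! ## §4. Continuity of the derivative families -/

/-- `φ ↦ (ev_v) ∘ U″φ` is continuous. [folklore] -/
theorem continuous_entry_one_fderiv (hU''c : Continuous U'') (v : EuclideanSpace ℝ ι) :
    Continuous fun φ : EuclideanSpace ℝ ι => (ContinuousLinearMap.apply ℝ ℝ v).comp (U'' φ) := hU''c.const_clm_comp _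

/-- `φ ↦ (ev_y ∘ ev_x) ∘ U‴φ` is continuous. [folklore] -/
theorem continuous_entry_two_fderiv (hU₃c : Continuous U₃) (x y : EuclideanSpace ℝ ι) :
    Continuous fun φ : EuclideanSpace ℝ ι => ((ContinuousLinearMap.apply ℝ ℝ y).comp (ContinuousLinearMap.apply ℝ (EuclideanSpace ℝ ι →L[ℝ] ℝ)
        x)).comp (U₃ φ) :=
  hU₃c.const_clm_comp _

/-- `φ ↦ (ev_z ∘ ev_y ∘ ev_x) ∘ U⁗φ` is continuous. [folklore] -/
theorem continuous_entry_three_fderiv (hU₄c : Continuous U₄) (x y z : EuclideanSpace ℝ ι) :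
    Continuous fun φ : EuclideanSpace ℝ ι => (((ContinuousLinearMap.apply ℝ ℝ z).comp (ContinuousLinearMap.apply ℝ (EuclideanSpace ℝ ι →L[ℝ] ℝ)
        y)).comp (ContinuousLinearMap.apply ℝ (EuclideanSpace ℝ ι →L[ℝ] EuclideanSpace ℝ ι →L[ℝ] ℝ) x)).comp (U₄ φ) :=
  hU₄c.const_clm_comp _

set_option synthInstance.maxHeartbeats 200000 in
/-- `φ ↦ (ev_l ∘ ev_k ∘ ev_h ∘ ev_m) ∘ U⁽⁵⁾φ` is continuous. [folklore] -/
theorem continuous_entry_four_fderiv (hU₅c : Continuous U₅) (m h k l : EuclideanSpace ℝ ι) :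
    Continuous fun φ : EuclideanSpace ℝ ι => ((((ContinuousLinearMap.apply ℝ ℝ l).comp (ContinuousLinearMap.apply ℝ (EuclideanSpace ℝ ι →L[ℝ] ℝ)
        k)).comp (ContinuousLinearMap.apply ℝ (EuclideanSpace ℝ ι →L[ℝ] EuclideanSpace ℝ ι →L[ℝ] ℝ) h)).comp
        (ContinuousLinearMap.apply ℝ (EuclideanSpace ℝ ι →L[ℝ] EuclideanSpace ℝ ι →L[ℝ] EuclideanSpace ℝ ι →L[ℝ] ℝ) m)).comp (U₅ φ) :=
  hU₅c.const_clm_comp _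

/-! ## Toy -/

/-- Toy (one constant for value and derivative): `2 ≤ 2 + 3` and `3 ≤ 2 + 3`. -/
example : (2 : ℝ) ≤ 2 + 3 ∧ (3 : ℝ) ≤ 2 + 3 := by norm_num

end Summit.QuantumFields.BalabanUV.T4Continuum.NE7b.SupFifthFormObservables

end
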